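import Literature.Probability.Percolation.EnhancedClusterModification
import Literature.Probability.Percolation.QSMPolynomials
import Literature.Probability.Percolation.RussoFormula
import HarnessLib

/-!
# `Θ_L(p,s)`, Russo's formula and the Aizenman–Grimmett differential inequality for the enhanced cluster
# (Martineau–Severo 2019, Proposition 4.2 / §6), on the explicit polynomial

Fifth file of the inline proof of `Literature.Probability.Percolation.MartineauSevero2019_cor22`.
Martineau–Severo (Ann. Probab. 47 (2019), §6) consider `θ_L(p,s) = ℙ_{p,s}(𝓔_L)` under
`ℙ_{p,s} = Ber(p)^{⊗E(ℋ)} ⊗ Ber(s)^{⊗V(ℋ)}`, apply the Margulis–Russo formula in each parameter, deduce from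
Lemma 6.1 the differential inequality (diffineq) `∂θ_L/∂s ≥ c ∂θ_L/∂p` with `c` uniform in `L`, and
integrate it along a line segment `(𝐩(t), 𝐬(t))` with `𝐩'/𝐬' = -c`, along which `t ↦ θ_L(𝐩(t),𝐬(t))` is
non-decreasing. Since `𝓔_L` is determined by the finite window `K = enhWindow H r o L`
(`determinedBy_enhEvent_enhWindow`), all of this is finite-dimensional and — exactly as in the tree's
column-model file `QSMPolynomials.lean`, whose generic `ProdWeight` toolkit (weighted counts `gTheta`, pivotal
counts `gPiv`, Russo's formula `hasDerivAt_gTheta`) we reuse — we carry it out on the explicit polynomial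

  `Θ_L(p,s) = Σ_{S ⊆ K, S ∈ 𝓔_L} ∏_{i ∈ K} w_i(S)`, `w_i(S) ∈ {p, 1-p, s, 1-s}` (`enhTheta`),

whose identification with probabilities is made in the sequel files. Contents:

* `enhPar`, `enhTheta`, `enhPiv`; Russo's formula along a line `hasDerivAt_enhTheta_line`; monotonicity of
  `Θ_L` in `p` and in `s` (`enhTheta_mono_p`, `enhTheta_mono_s`).
* `exists_modified_cfg` — Lemma 6.1 (`exists_local_modification`) transported to finite configurations
  `S ⊆ K` with the finite-energy weight comparison `μ₀^{|Loc e|} w(S) ≤ w(S')` (`μ₀ ≤ min(p,1-p)`; marks are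
  only removed, so `s ≤ 1/2` suffices on the mark coordinates) and agreement off `Loc e = K ∩ modWindow e`.
* **The Aizenman–Grimmett inequality** `sum_enhPiv_inl_le` ((goal) summed over `e`):
  `Σ_e Piv_e ≤ C Σ_z Piv_z`, `C = μ₀^{-N_L} 2^{N_L} N_O` from uniform bounds `N_L ≥ |Loc e|`,
  `N_O ≥ #{e : z near e}`; `card_loc_le`, `card_near_le` derive such bounds, uniform in `L`, from per-vertex
  bounds on `|E(B_{3r+4}(x))|` and `|B_{3r+4}(x)|` (bounded degree).
* `enhTheta_line_mono` — integration along `(p₀ - κt, t)`, `t ∈ [0,t₁]`, `κ C ≤ 1`: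
  `Θ_L(p₀, 0) ≤ Θ_L(p₀ - κt₁, t₁)`; with the two monotonicities, `enhTheta_ge_corner`:
  `Θ_L(p₀,0) ≤ Θ_L(p,s)` for all `p ≥ p₀ - κ t₁`, `s ≥ t₁` (Proposition 4.2 in polynomial form).

## References

* S. Martineau, F. Severo, Ann. Probab. 47 (2019), §6 ((diffineq), (goal), the segment argument),
  Proposition 4.2 [MartineauSevero2019].
* M. Aizenman, G. Grimmett, J. Stat. Phys. 63 (1991) 817–835 [AizenmanGrimmett1991].
* L. Russo, Z. Wahrsch. verw. Gebiete 56 (1981), §4 Lemma 3 [RussoZW1981].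
-/

namespace Literature.Probability.Percolation

open Literature.Barriers.CriticalPhenomena

variable {W : Type*}

/-! ### Parameters, `Θ_L` and the pivotal counts -/

/-- The parameter of a coordinate of `E ⊔ V`: `p` for edges, `s` for marks (`ℙ_{p,s}`).
[cite: MartineauSevero2019, §4 (ℙ_{p,s})] -/
def enhPar (p s : ℝ) : Sym2 W ⊕ W → ℝ := fun i => Sum.elim (fun _ => p) (fun _ => s) i

/-- `enhPar` on an edge coordinate. [folklore] -/
@[simp] theorem enhPar_inl (p s : ℝ) (e : Sym2 W) : enhPar p s (Sum.inl e) = p := rfl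

/-- `enhPar` on a mark coordinate. [folklore] -/
@[simp] theorem enhPar_inr (p s : ℝ) (v : W) : enhPar p s (Sum.inr v) = s := rfl

/-- Parameters in `[0,1]` coordinatewise. [folklore] -/
theorem enhPar_mem {p s : ℝ} (hp : 0 ≤ p ∧ p ≤ 1) (hs : 0 ≤ s ∧ s ≤ 1) (i : Sym2 W ⊕ W) :
    0 ≤ enhPar p s i ∧ enhPar p s i ≤ 1 := by
  cases i with
  | inl _ => exact hp
  | inr _ => exact hs

section Theta

variable (H : SimpleGraph W) [H.LocallyFinite] (r : ℕ) (o : W)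

/-- **`Θ_L(p,s)`**: the weighted count of the configurations of the window `K = enhWindow H r o L` lying in
`𝓔_L` — the polynomial which is `ℙ_{p,s}(𝓔_L) = θ_L(p,s)` of Martineau–Severo, §6.
[cite: MartineauSevero2019, §6 (θ_L(p,s))] -/
noncomputable def enhTheta (L : ℕ) (p s : ℝ) : ℝ :=
  ProdWeight.gTheta (enhWindow H r o L) (enhEvent H r o L) (enhPar p s)

/-- The weighted count of the configurations in which the coordinate `i` is pivotal for `𝓔_L`
(`ℙ_{p,s}(e is p-pivotal)`, `ℙ_{p,s}(x is s-pivotal)`). [cite: MartineauSevero2019, §6 (Margulis–Russo formula)] -/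
noncomputable def enhPiv (L : ℕ) (p s : ℝ) (i : Sym2 W ⊕ W) : ℝ :=
  ProdWeight.gPiv (enhWindow H r o L) (enhEvent H r o L) (enhPar p s) i

variable {H r o}

/-- Pivotal counts are non-negative. [folklore] -/
theorem enhPiv_nonneg (L : ℕ) {p s : ℝ} (hp : 0 ≤ p ∧ p ≤ 1) (hs : 0 ≤ s ∧ s ≤ 1) (i : Sym2 W ⊕ W) :
    0 ≤ enhPiv H r o L p s i :=
  ProdWeight.gPiv_nonneg _ _ (enhPar_mem hp hs) i

/-- **Russo's formula for `Θ_L` along the line `(p₀ + at, s₀ + bt)`** (Margulis–Russo in each parameter and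
the chain rule). [cite: MartineauSevero2019, §6 (Margulis–Russo formula)] -/
theorem hasDerivAt_enhTheta_line (L : ℕ) (p₀ a s₀ b t : ℝ) :
    HasDerivAt (fun t => enhTheta H r o L (p₀ + a * t) (s₀ + b * t))
      (a * ∑ e ∈ edgesInBallFin H o (L + r), enhPiv H r o L (p₀ + a * t) (s₀ + b * t) (Sum.inl e) +
        b * ∑ v ∈ ballFin H o L, enhPiv H r o L (p₀ + a * t) (s₀ + b * t) (Sum.inr v)) t := by
  have hq : ∀ i ∈ enhWindow H r o L, HasDerivAt (fun t => enhPar (W := W) (p₀ + a * t) (s₀ + b * t) i)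
      (Sum.elim (fun _ => a) (fun _ => b) i) t := by
    intro i _
    cases i with
    | inl e =>
      simp only [enhPar, Sum.elim_inl]
      have := ((hasDerivAt_id t).const_mul a).const_add p₀
      simpa using this
    | inr v =>
      simp only [enhPar, Sum.elim_inr]
      have := ((hasDerivAt_id t).const_mul b).const_add s₀
      simpa using this
  have h := ProdWeight.hasDerivAt_gTheta (isUpperSet_enhEvent H r o L) (enhWindow H r o L) hq
  refine h.congr_deriv ?_
  simp only [enhPiv, enhWindow, Finset.sum_disjSum, Sum.elim_inl, Sum.elim_inr, Finset.mul_sum]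

/-- **`Θ_L` is non-decreasing in `s`** (`𝓔_L` increasing in `α`). [cite: MartineauSevero2019, §6 ("By monotonicity")] -/
theorem enhTheta_mono_s (L : ℕ) {p s s' : ℝ} (hp0 : 0 ≤ p) (hp1 : p ≤ 1) (hs0 : 0 ≤ s) (hss' : s ≤ s')
    (hs'1 : s' ≤ 1) : enhTheta H r o L p s ≤ enhTheta H r o L p s' := by
  set F : ℝ → ℝ := fun t => enhTheta H r o L (p + 0 * t) (0 + 1 * t) with hF
  have hderiv := fun t => hasDerivAt_enhTheta_line (H := H) (r := r) (o := o) L p 0 0 1 t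
  have hmono : MonotoneOn F (Set.Icc 0 1) := by
    refine monotoneOn_of_hasDerivWithinAt_nonneg (convex_Icc 0 1)
      (fun t _ => (hderiv t).continuousAt.continuousWithinAt)
      (fun t _ => (hderiv t).hasDerivWithinAt) fun t ht => ?_
    rw [interior_Icc] at ht
    have hB : 0 ≤ ∑ v ∈ ballFin H o L, enhPiv H r o L (p + 0 * t) (0 + 1 * t) (Sum.inr v) :=
      Finset.sum_nonneg fun v _ => enhPiv_nonneg L ⟨by linarith, by linarith⟩ ⟨by linarith [ht.1], by linarith [ht.2]⟩ _
    simpa using hB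
  have h := hmono ⟨hs0, hss'.trans hs'1⟩ ⟨hs0.trans hss', hs'1⟩ hss'
  simpa [hF] using h

/-- **`Θ_L` is non-decreasing in `p`** (`𝓔_L` increasing in `ω`). [cite: MartineauSevero2019, §6 ("By monotonicity")] -/
theorem enhTheta_mono_p (L : ℕ) {p p' s : ℝ} (hs0 : 0 ≤ s) (hs1 : s ≤ 1) (hp0 : 0 ≤ p) (hpp' : p ≤ p')
    (hp'1 : p' ≤ 1) : enhTheta H r o L p s ≤ enhTheta H r o L p' s := by
  set F : ℝ → ℝ := fun t => enhTheta H r o L (0 + 1 * t) (s + 0 * t) with hF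
  have hderiv := fun t => hasDerivAt_enhTheta_line (H := H) (r := r) (o := o) L 0 1 s 0 t
  have hmono : MonotoneOn F (Set.Icc 0 1) := by
    refine monotoneOn_of_hasDerivWithinAt_nonneg (convex_Icc 0 1)
      (fun t _ => (hderiv t).continuousAt.continuousWithinAt)
      (fun t _ => (hderiv t).hasDerivWithinAt) fun t ht => ?_
    rw [interior_Icc] at ht
    have hA : 0 ≤ ∑ e ∈ edgesInBallFin H o (L + r), enhPiv H r o L (0 + 1 * t) (s + 0 * t) (Sum.inl e) :=
      Finset.sum_nonneg fun e _ => enhPiv_nonneg L ⟨by linarith [ht.1], by linarith [ht.2]⟩ ⟨by linarith, by linarith⟩ _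
    simpa using hA
  have h := hmono ⟨hp0, hpp'.trans hp'1⟩ ⟨hp0.trans hpp', hp'1⟩ hpp'
  simpa [hF] using h

end Theta

/-! ### The local modification on finite configurations -/

section AG

variable {H : SimpleGraph W} [H.LocallyFinite] {r : ℕ} {o : W}

open scoped Classical

/-- Pivotality only depends on the trace on a determining set. [folklore] -/
theorem isPivotal_inter_iff {ι : Type*} {A : Set (Set ι)} {K : Set ι} (hA : DeterminedBy A K) (i : ι)
    (ξ : Set ι) : IsPivotal A i (ξ ∩ K) ↔ IsPivotal A i ξ := by
  rw [determinedBy_iff] at hA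
  have h1 : insert i (ξ ∩ K) ∩ K = insert i ξ ∩ K := by
    ext j; simp only [Set.mem_inter_iff, Set.mem_insert_iff]; tauto
  have h2 : (ξ ∩ K) \ {i} ∩ K = (ξ \ {i}) ∩ K := by
    ext j; simp only [Set.mem_inter_iff, Set.mem_sdiff]; tauto
  unfold IsPivotal
  rw [hA _ _ h1, hA _ _ h2]

/-- The coordinates of the window inside the modification window of `e`. [cite: MartineauSevero2019, Lemma 6.1 (B_R(e))] -/
noncomputable def locF (H : SimpleGraph W) [H.LocallyFinite] (r : ℕ) (o : W) (L : ℕ) (e : Sym2 W) :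
    Finset (Sym2 W ⊕ W) :=
  (enhWindow H r o L).filter fun i => i ∈ modWindow H r e

/-- `z` is **near** `e`: within distance `3r+3` of an endpoint. [cite: MartineauSevero2019, Lemma 6.1 (z ∈ B_R(e))] -/
def NearEdge (H : SimpleGraph W) (r : ℕ) (e : Sym2 W) (z : W) : Prop :=
  ∃ x ∈ e, z ∈ graphBall H x (3 * r + 3)

/-- **One local modification, on finite configurations** (Lemma 6.1 ⟹ (goal)): for `e` pivotal in
`S ⊆ K`, there is `S' ⊆ K` in which some `z ∈ B_L(o)` near `e` is pivotal, whose weight is at least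
`μ₀^{|Loc e|}` times that of `S` (`μ₀ ≤ min(p, 1-p)`, `s ≤ 1/2`), and which agrees with `S` off `Loc e`.
[cite: MartineauSevero2019, §6 (Lemma 6.1 ⟹ (goal))] -/
theorem exists_modified_cfg (hH : H.Connected) {L : ℕ} (hL : r + 1 ≤ L) {p s μ₀ : ℝ} (hμ₀ : 0 ≤ μ₀)
    (hμ1 : μ₀ ≤ 1) (hμp : μ₀ ≤ p) (hμp' : μ₀ ≤ 1 - p) (hs0 : 0 ≤ s) (hs : s ≤ 1 / 2)
    {e : Sym2 W} (he : e ∈ H.edgeSet) {S : Finset (Sym2 W ⊕ W)} (hSK : S ⊆ enhWindow H r o L)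
    (hpiv : IsPivotal (enhEvent H r o L) (Sum.inl e) (↑S : Set (Sym2 W ⊕ W))) :
    ∃ S' : Finset (Sym2 W ⊕ W), S' ⊆ enhWindow H r o L ∧
      (∃ z ∈ ballFin H o L, NearEdge H r e z ∧ IsPivotal (enhEvent H r o L) (Sum.inr z) (↑S' : Set (Sym2 W ⊕ W))) ∧
      μ₀ ^ (locF H r o L e).card * ProdWeight.gW (enhWindow H r o L) (enhPar p s) S ≤
        ProdWeight.gW (enhWindow H r o L) (enhPar p s) S' ∧
      S.filter (fun i => i ∉ locF H r o L e) = S'.filter (fun i => i ∉ locF H r o L e) := by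
  set K := enhWindow H r o L with hK
  have hdet : DeterminedBy (enhEvent H r o L) ↑K := determinedBy_enhEvent_enhWindow hH r o L
  obtain ⟨ξ', z, hoff, hmarks, hnear, hpivz⟩ := exists_local_modification hH hL he hpiv
  set S' : Finset (Sym2 W ⊕ W) := K.filter fun i => i ∈ ξ' with hS'
  have hS'K : S' ⊆ K := Finset.filter_subset _ _
  have hcoeS' : (↑S' : Set (Sym2 W ⊕ W)) = ξ' ∩ ↑K := by
    ext i; simp [hS', and_comm]
  have memS' : ∀ i, i ∈ S' ↔ i ∈ K ∧ i ∈ ξ' := fun i => by simp [hS']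
  -- `z` is pivotal in `S'`, hence lies in the window
  have hpivS' : IsPivotal (enhEvent H r o L) (Sum.inr z) (↑S' : Set (Sym2 W ⊕ W)) := by
    rw [hcoeS', isPivotal_inter_iff hdet]; exact hpivz
  have hzK : (Sum.inr z : Sym2 W ⊕ W) ∈ K := Russo.mem_of_isPivotal hdet hpivS'
  have hzL : z ∈ ballFin H o L := by
    have := inr_mem_enhWindow.1 hzK
    simpa using this
  -- off `locF e` nothing changes
  have hagree : ∀ i, i ∉ locF H r o L e → (i ∈ S ↔ i ∈ S') := by
    intro i hi
    have hi' : i ∈ K → i ∉ modWindow H r e := fun hiK hm => hi (Finset.mem_filter.2 ⟨hiK, hm⟩)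
    constructor
    · intro hiS
      have hiK := hSK hiS
      exact (memS' i).2 ⟨hiK, (hoff i (hi' hiK)).2 hiS⟩
    · intro hiS'
      obtain ⟨hiK, hiξ⟩ := (memS' i).1 hiS'
      exact (hoff i (hi' hiK)).1 hiξ
  refine ⟨S', hS'K, ⟨z, hzL, hnear, hpivS'⟩, ?_, ?_⟩
  · -- weight comparison
    set cc : Sym2 W ⊕ W → ℝ := fun i => if i ∈ locF H r o L e then μ₀ else 1 with hcc
    have hq := enhPar_mem (W := W) (p := p) (s := s) ⟨hμ₀.trans hμp, by linarith⟩ ⟨hs0, by linarith⟩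
    have hfac : ∀ i ∈ K, cc i * ProdWeight.gwt (enhPar p s) S i ≤ ProdWeight.gwt (enhPar p s) S' i := by
      intro i hiK
      by_cases hiL : i ∈ locF H r o L e
      · simp only [hcc, hiL, if_true]
        cases i with
        | inl f =>
          -- a changed edge: finite energy
          calc μ₀ * ProdWeight.gwt (enhPar p s) S (Sum.inl f)
              ≤ μ₀ * 1 := mul_le_mul_of_nonneg_left (ProdWeight.gwt_le_one hq S _) hμ₀
            _ ≤ ProdWeight.gwt (enhPar p s) S' (Sum.inl f) := by
              rw [mul_one]
              unfold ProdWeight.gwt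
              split_ifs
              · exact hμp
              · simpa [enhPar] using hμp'
        | inr v =>
          -- a mark: only removed, and `s ≤ 1/2`
          unfold ProdWeight.gwt
          by_cases h1 : (Sum.inr v : Sym2 W ⊕ W) ∈ S'
          · have h2 : (Sum.inr v : Sym2 W ⊕ W) ∈ S := hmarks v ((memS' _).1 h1).2
            simp only [h1, h2, if_true, enhPar_inr]
            nlinarith
          · by_cases h2 : (Sum.inr v : Sym2 W ⊕ W) ∈ S
            · simp only [h2, if_true, h1, if_false, enhPar_inr]
              nlinarith
            · simp only [h2, h1, if_false, enhPar_inr]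
              nlinarith
      · simp only [hcc, hiL, if_false, one_mul]
        have := hagree i hiL
        unfold ProdWeight.gwt
        by_cases h : i ∈ S
        · have h' := this.1 h
          simp [h, h']
        · have h' : i ∉ S' := fun x => h (this.2 x)
          simp [h, h']
    have hcc0 : ∀ i ∈ K, 0 ≤ cc i * ProdWeight.gwt (enhPar p s) S i := fun i _ =>
      mul_nonneg (by simp only [hcc]; split_ifs <;> linarith) (ProdWeight.gwt_nonneg hq S i)
    have hprod : (∏ i ∈ K, cc i) * ProdWeight.gW K (enhPar p s) S ≤ ProdWeight.gW K (enhPar p s) S' := by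
      unfold ProdWeight.gW
      rw [← Finset.prod_mul_distrib]
      exact Finset.prod_le_prod hcc0 hfac
    have hcprod : μ₀ ^ (locF H r o L e).card ≤ ∏ i ∈ K, cc i := by
      rw [Finset.prod_ite, Finset.prod_const_one, mul_one, Finset.prod_const]
      refine pow_le_pow_of_le_one hμ₀ hμ1 ?_
      exact Finset.card_le_card fun i hi => (Finset.mem_filter.1 hi).2
    calc μ₀ ^ (locF H r o L e).card * ProdWeight.gW K (enhPar p s) S
        ≤ (∏ i ∈ K, cc i) * ProdWeight.gW K (enhPar p s) S :=
          mul_le_mul_of_nonneg_right hcprod (ProdWeight.gW_nonneg _ hq S)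
      _ ≤ ProdWeight.gW K (enhPar p s) S' := hprod
  · ext i
    simp only [Finset.mem_filter]
    constructor
    · rintro ⟨hi, hiL⟩; exact ⟨(hagree i hiL).1 hi, hiL⟩
    · rintro ⟨hi, hiL⟩; exact ⟨(hagree i hiL).2 hi, hiL⟩

/-- **(goal) for one edge**: if `|Loc e| ≤ N_L` then
`Piv_e ≤ μ₀^{-N_L} 2^{N_L} Σ_{z ∈ B_L(o) near e} Piv_z`. [cite: MartineauSevero2019, §6 (goal)] -/
theorem enhPiv_inl_le (hH : H.Connected) {L : ℕ} (hL : r + 1 ≤ L) {p s μ₀ : ℝ} (hμ₀ : 0 < μ₀)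
    (hμ1 : μ₀ ≤ 1) (hμp : μ₀ ≤ p) (hμp' : μ₀ ≤ 1 - p) (hs0 : 0 ≤ s) (hs : s ≤ 1 / 2)
    {e : Sym2 W} (he : e ∈ H.edgeSet) {NL : ℕ} (hNL : (locF H r o L e).card ≤ NL) :
    enhPiv H r o L p s (Sum.inl e) ≤ (μ₀ ^ NL)⁻¹ * 2 ^ NL *
      ∑ z ∈ (ballFin H o L).filter (fun z => NearEdge H r e z), enhPiv H r o L p s (Sum.inr z) := by
  set K := enhWindow H r o L with hK
  set q := enhPar (W := W) p s with hq_def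
  have hq := enhPar_mem (W := W) (p := p) (s := s) ⟨hμ₀.le.trans hμp, by linarith⟩ ⟨hs0, by linarith⟩
  set D : Finset (Finset (Sym2 W ⊕ W)) :=
    K.powerset.filter fun S => IsPivotal (enhEvent H r o L) (Sum.inl e) (↑S : Set (Sym2 W ⊕ W)) with hD
  -- the modification map
  have hex : ∀ S ∈ D, ∃ S' : Finset (Sym2 W ⊕ W), S' ⊆ K ∧
      (∃ z ∈ ballFin H o L, NearEdge H r e z ∧ IsPivotal (enhEvent H r o L) (Sum.inr z) (↑S' : Set (Sym2 W ⊕ W))) ∧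
      μ₀ ^ NL * ProdWeight.gW K q S ≤ ProdWeight.gW K q S' ∧
      S.filter (fun i => i ∉ locF H r o L e) = S'.filter (fun i => i ∉ locF H r o L e) := by
    intro S hS
    obtain ⟨hSK, hpiv⟩ := Finset.mem_filter.1 hS
    obtain ⟨S', h1, h2, h3, h4⟩ :=
      exists_modified_cfg hH hL hμ₀.le hμ1 hμp hμp' hs0 hs he (Finset.mem_powerset.1 hSK) hpiv
    refine ⟨S', h1, h2, le_trans ?_ h3, h4⟩
    exact mul_le_mul_of_nonneg_right (pow_le_pow_of_le_one hμ₀.le hμ1 hNL) (ProdWeight.gW_nonneg _ hq S)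
  choose! Φ hΦK hΦpiv hΦw hΦoff using hex
  -- Step A: finite energy
  have hA : enhPiv H r o L p s (Sum.inl e) ≤ (μ₀ ^ NL)⁻¹ * ∑ S ∈ D, ProdWeight.gW K q (Φ S) := by
    have hPiv : enhPiv H r o L p s (Sum.inl e) = ∑ S ∈ D, ProdWeight.gW K q S := by
      rw [enhPiv, ProdWeight.gPiv, hD, Finset.sum_filter]
    rw [hPiv, Finset.mul_sum]
    refine Finset.sum_le_sum fun S hS => ?_
    have hμn : 0 < μ₀ ^ NL := pow_pos hμ₀ _
    rw [← div_le_iff₀' (inv_pos.2 hμn), div_inv_eq_mul, mul_comm]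
    exact hΦw S hS
  -- Step B: bounded fibres
  have hB : ∑ S ∈ D, ProdWeight.gW K q (Φ S) ≤ 2 ^ NL * ∑ S' ∈ D.image Φ, ProdWeight.gW K q S' := by
    rw [Finset.sum_comp, Finset.mul_sum]
    refine Finset.sum_le_sum fun S' hS' => ?_
    rw [nsmul_eq_mul]
    refine mul_le_mul_of_nonneg_right ?_ (ProdWeight.gW_nonneg _ hq S')
    have hcard : (D.filter fun S => Φ S = S').card ≤ (locF H r o L e).powerset.card := by
      refine Finset.card_le_card_of_injOn (fun S => S.filter fun i => i ∈ locF H r o L e) ?_ ?_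
      · intro S _
        simp only [Finset.coe_powerset, Set.mem_preimage, Set.mem_powerset_iff, Finset.coe_subset]
        exact fun i hi => (Finset.mem_filter.1 hi).2
      · intro S₁ hS₁ S₂ hS₂ hEq
        simp only [Finset.coe_filter, Set.mem_setOf_eq] at hS₁ hS₂
        have h1 := hΦoff S₁ hS₁.1
        have h2 := hΦoff S₂ hS₂.1
        rw [hS₁.2] at h1
        rw [hS₂.2] at h2
        rw [← Finset.filter_union_filter_not_eq (fun i => i ∈ locF H r o L e) S₁,
          ← Finset.filter_union_filter_not_eq (fun i => i ∈ locF H r o L e) S₂]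
        simp only at hEq
        rw [hEq, h1, ← h2]
    calc ((D.filter fun S => Φ S = S').card : ℝ) ≤ ((locF H r o L e).powerset.card : ℝ) := by
          exact_mod_cast hcard
      _ = 2 ^ (locF H r o L e).card := by rw [Finset.card_powerset]; push_cast; ring
      _ ≤ 2 ^ NL := pow_le_pow_right₀ (by norm_num) hNL
  -- Step C: the images have a pivotal vertex near `e`
  set near := (ballFin H o L).filter (fun z => NearEdge H r e z) with hnear
  have hC : ∑ S' ∈ D.image Φ, ProdWeight.gW K q S' ≤ ∑ z ∈ near, enhPiv H r o L p s (Sum.inr z) := by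
    set P : Finset (Sym2 W ⊕ W) → Prop := fun S' =>
      ∃ z ∈ near, IsPivotal (enhEvent H r o L) (Sum.inr z) (↑S' : Set (Sym2 W ⊕ W)) with hP
    have hsub : D.image Φ ⊆ K.powerset.filter P := by
      intro S' hS'
      obtain ⟨S, hS, rfl⟩ := Finset.mem_image.1 hS'
      refine Finset.mem_filter.2 ⟨Finset.mem_powerset.2 (hΦK S hS), ?_⟩
      obtain ⟨z, hz, hzn, hpiv⟩ := hΦpiv S hS
      exact ⟨z, Finset.mem_filter.2 ⟨hz, hzn⟩, hpiv⟩
    set g : Finset (Sym2 W ⊕ W) → W → ℝ := fun S' z =>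
      if IsPivotal (enhEvent H r o L) (Sum.inr z) (↑S' : Set (Sym2 W ⊕ W)) then ProdWeight.gW K q S' else 0 with hg
    have hg0 : ∀ S' z, 0 ≤ g S' z := fun S' z => by
      simp only [hg]
      split_ifs
      · exact ProdWeight.gW_nonneg _ hq S'
      · exact le_rfl
    calc ∑ S' ∈ D.image Φ, ProdWeight.gW K q S'
        ≤ ∑ S' ∈ K.powerset.filter P, ProdWeight.gW K q S' :=
          Finset.sum_le_sum_of_subset_of_nonneg hsub fun S' _ _ => ProdWeight.gW_nonneg _ hq S'
      _ ≤ ∑ S' ∈ K.powerset.filter P, ∑ z ∈ near, g S' z := by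
          refine Finset.sum_le_sum fun S' hS' => ?_
          obtain ⟨-, z, hz, hpiv⟩ := Finset.mem_filter.1 hS'
          have hle : g S' z ≤ ∑ z' ∈ near, g S' z' := Finset.single_le_sum (f := g S') (fun z' _ => hg0 S' z') hz
          have hgz : g S' z = ProdWeight.gW K q S' := by simp [hg, hpiv]
          rw [hgz] at hle
          exact hle
      _ ≤ ∑ S' ∈ K.powerset, ∑ z ∈ near, g S' z :=
          Finset.sum_le_sum_of_subset_of_nonneg (Finset.filter_subset _ _) fun S' _ _ =>
            Finset.sum_nonneg fun z _ => hg0 S' z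
      _ = ∑ z ∈ near, enhPiv H r o L p s (Sum.inr z) := by
          rw [Finset.sum_comm]
          rfl
  have h2pos : (0 : ℝ) ≤ 2 ^ NL := by positivity
  have hμinv : (0 : ℝ) ≤ (μ₀ ^ NL)⁻¹ := inv_nonneg.2 (pow_nonneg hμ₀.le _)
  calc enhPiv H r o L p s (Sum.inl e)
      ≤ (μ₀ ^ NL)⁻¹ * ∑ S ∈ D, ProdWeight.gW K q (Φ S) := hA
    _ ≤ (μ₀ ^ NL)⁻¹ * (2 ^ NL * ∑ S' ∈ D.image Φ, ProdWeight.gW K q S') := mul_le_mul_of_nonneg_left hB hμinv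
    _ ≤ (μ₀ ^ NL)⁻¹ * (2 ^ NL * ∑ z ∈ near, enhPiv H r o L p s (Sum.inr z)) :=
        mul_le_mul_of_nonneg_left (mul_le_mul_of_nonneg_left hC h2pos) hμinv
    _ = _ := by ring

/-- The constant of the Aizenman–Grimmett inequality: `C = μ₀^{-N_L} · 2^{N_L} · N_O` (finite energy, fibre
multiplicity, overlap of the modification windows). [cite: MartineauSevero2019, §6 ((goal) and the constant C)] -/
noncomputable def enhAGconst (μ₀ : ℝ) (NL NO : ℕ) : ℝ := (μ₀ ^ NL)⁻¹ * 2 ^ NL * NO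

/-- The Aizenman–Grimmett constant is non-negative. [folklore] -/
theorem enhAGconst_nonneg {μ₀ : ℝ} (hμ₀ : 0 ≤ μ₀) (NL NO : ℕ) : 0 ≤ enhAGconst μ₀ NL NO := by
  unfold enhAGconst
  exact mul_nonneg (mul_nonneg (inv_nonneg.2 (pow_nonneg hμ₀ _)) (by positivity)) (Nat.cast_nonneg _)

/-- **The Aizenman–Grimmett inequality for the enhanced cluster** ((goal) summed over `e`, giving
(diffineq)): with uniform bounds `|Loc e| ≤ N_L` and `#{e : z near e} ≤ N_O`, `min(p,1-p) ≥ μ₀ > 0`,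
`0 ≤ s ≤ 1/2` and `L ≥ r+1`:
`Σ_{e ∈ E(B_{L+r}(o))} Piv_e(p,s) ≤ C · Σ_{z ∈ B_L(o)} Piv_z(p,s)`. [cite: MartineauSevero2019, §6 ((goal) ⟹ (diffineq))] -/
theorem sum_enhPiv_inl_le (hH : H.Connected) {L : ℕ} (hL : r + 1 ≤ L) {p s μ₀ : ℝ} (hμ₀ : 0 < μ₀)
    (hμ1 : μ₀ ≤ 1) (hμp : μ₀ ≤ p) (hμp' : μ₀ ≤ 1 - p) (hs0 : 0 ≤ s) (hs : s ≤ 1 / 2) {NL NO : ℕ}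
    (hNL : ∀ e ∈ edgesInBallFin H o (L + r), (locF H r o L e).card ≤ NL)
    (hNO : ∀ z, ((edgesInBallFin H o (L + r)).filter fun e => NearEdge H r e z).card ≤ NO) :
    ∑ e ∈ edgesInBallFin H o (L + r), enhPiv H r o L p s (Sum.inl e) ≤
      enhAGconst μ₀ NL NO * ∑ z ∈ ballFin H o L, enhPiv H r o L p s (Sum.inr z) := by
  set C₁ : ℝ := (μ₀ ^ NL)⁻¹ * 2 ^ NL with hC₁
  have hC₁0 : 0 ≤ C₁ := mul_nonneg (inv_nonneg.2 (pow_nonneg hμ₀.le _)) (by positivity)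
  have hPiv0 : ∀ z, 0 ≤ enhPiv H r o L p s (Sum.inr z) := fun z =>
    enhPiv_nonneg L ⟨hμ₀.le.trans hμp, by linarith⟩ ⟨hs0, by linarith⟩ _
  set EF := edgesInBallFin H o (L + r) with hEF
  set VF := ballFin H o L with hVF
  calc ∑ e ∈ EF, enhPiv H r o L p s (Sum.inl e)
      ≤ ∑ e ∈ EF, C₁ * ∑ z ∈ VF.filter (fun z => NearEdge H r e z), enhPiv H r o L p s (Sum.inr z) :=
        Finset.sum_le_sum fun e he => enhPiv_inl_le hH hL hμ₀ hμ1 hμp hμp' hs0 hs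
          (edgesInBall_subset_edgeSet H o _ (mem_edgesInBallFin.1 he)) (hNL e he)
    _ = C₁ * ∑ e ∈ EF, ∑ z ∈ VF, (if NearEdge H r e z then enhPiv H r o L p s (Sum.inr z) else 0) := by
        rw [← Finset.mul_sum]
        refine congrArg (C₁ * ·) (Finset.sum_congr rfl fun e _ => ?_)
        rw [Finset.sum_filter]
    _ = C₁ * ∑ z ∈ VF, ∑ e ∈ EF, (if NearEdge H r e z then enhPiv H r o L p s (Sum.inr z) else 0) := by
        rw [Finset.sum_comm]
    _ = C₁ * ∑ z ∈ VF, ((EF.filter fun e => NearEdge H r e z).card : ℝ) * enhPiv H r o L p s (Sum.inr z) := by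
        refine congrArg (C₁ * ·) (Finset.sum_congr rfl fun z _ => ?_)
        rw [← Finset.sum_filter, Finset.sum_const, nsmul_eq_mul]
    _ ≤ C₁ * ∑ z ∈ VF, (NO : ℝ) * enhPiv H r o L p s (Sum.inr z) := by
        refine mul_le_mul_of_nonneg_left (Finset.sum_le_sum fun z _ => ?_) hC₁0
        refine mul_le_mul_of_nonneg_right ?_ (hPiv0 z)
        exact_mod_cast hNO z
    _ = enhAGconst μ₀ NL NO * ∑ z ∈ VF, enhPiv H r o L p s (Sum.inr z) := by
        rw [← Finset.mul_sum, hC₁, enhAGconst]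
        ring

/-! ### Uniform bounds from bounded geometry -/

/-- `|Loc e| ≤ 2 (N_E + N_V)` when `|E(B_{3r+4}(x))| ≤ N_E` and `|B_{3r+4}(x)| ≤ N_V` for all `x`.
[cite: MartineauSevero2019, §6 ("C := max_x |E(B_{R+1}(x))|")] -/
theorem card_locF_le {L : ℕ} {NE NV : ℕ} (hE : ∀ x, (edgesInBallFin H x (3 * r + 4)).card ≤ NE)
    (hV : ∀ x, (ballFin H x (3 * r + 4)).card ≤ NV) (e : Sym2 W) :
    (locF H r o L e).card ≤ 2 * (NE + NV) := by
  induction e using Sym2.inductionOn with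
  | hf a b =>
    set T : Finset (Sym2 W ⊕ W) :=
      ((edgesInBallFin H a (3 * r + 4) ∪ edgesInBallFin H b (3 * r + 4)).disjSum
        (ballFin H a (3 * r + 4) ∪ ballFin H b (3 * r + 4))) with hT
    have hsub : locF H r o L s(a, b) ⊆ T := by
      intro i hi
      obtain ⟨-, x, hx, hix⟩ := Finset.mem_filter.1 hi
      rcases hix with ⟨f, hf, rfl⟩ | ⟨v, hv, rfl⟩
      · refine Finset.inl_mem_disjSum.2 ?_
        have hf' : f ∈ edgesInBall H x (3 * r + 4) := edgesInBall_mono H x (by omega) hf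
        rcases Sym2.mem_iff.1 hx with rfl | rfl
        · exact Finset.mem_union_left _ (mem_edgesInBallFin.2 hf')
        · exact Finset.mem_union_right _ (mem_edgesInBallFin.2 hf')
      · refine Finset.inr_mem_disjSum.2 ?_
        rcases Sym2.mem_iff.1 hx with rfl | rfl
        · exact Finset.mem_union_left _ (mem_ballFin.2 hv)
        · exact Finset.mem_union_right _ (mem_ballFin.2 hv)
    calc (locF H r o L s(a, b)).card ≤ T.card := Finset.card_le_card hsub
      _ ≤ (edgesInBallFin H a (3 * r + 4)).card + (edgesInBallFin H b (3 * r + 4)).card +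
            ((ballFin H a (3 * r + 4)).card + (ballFin H b (3 * r + 4)).card) := by
          rw [hT, Finset.card_disjSum]
          exact Nat.add_le_add (Finset.card_union_le _ _) (Finset.card_union_le _ _)
      _ ≤ NE + NE + (NV + NV) := Nat.add_le_add (Nat.add_le_add (hE a) (hE b)) (Nat.add_le_add (hV a) (hV b))
      _ = 2 * (NE + NV) := by ring

/-- `#{e ∈ E : z near e} ≤ N_E` when `|E(B_{3r+4}(x))| ≤ N_E` for all `x`: an edge of `H` with an endpoint
within `3r+3` of `z` lies in `E(B_{3r+4}(z))`. [cite: MartineauSevero2019, §6 ("each vertex can be in B_R(e) for at most C different e's")] -/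
theorem card_near_le {NE : ℕ} (hE : ∀ x, (edgesInBallFin H x (3 * r + 4)).card ≤ NE)
    (EF : Finset (Sym2 W)) (hEF : ∀ e ∈ EF, e ∈ H.edgeSet) (z : W) :
    (EF.filter fun e => NearEdge H r e z).card ≤ NE := by
  refine le_trans (Finset.card_le_card fun e he => ?_) (hE z)
  obtain ⟨heE, x, hx, hzx⟩ := Finset.mem_filter.1 he
  rw [mem_edgesInBallFin]
  have hadj := hEF e heE
  refine ⟨hadj, ?_⟩
  have hxz : x ∈ graphBall H z (3 * r + 3) := mem_graphBall_symm hzx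
  induction e using Sym2.inductionOn with
  | hf a b =>
    have hab : H.Adj a b := hadj
    rcases Sym2.mem_iff.1 hx with rfl | rfl
    · exact ⟨graphBall_mono H z (by omega) hxz,
        graphBall_mono H z (by omega) (mem_graphBall_trans hxz (mem_graphBall_one_of_adj' hab))⟩
    · exact ⟨graphBall_mono H z (by omega) (mem_graphBall_trans hxz (mem_graphBall_one_of_adj' hab.symm)),
        graphBall_mono H z (by omega) hxz⟩

/-! ### Integration along the line -/

/-- **Integration of (diffineq) along the segment `(p₀ - κt, t)`, `t ∈ [0, t₁]`**: if `κ · C ≤ 1`, the segment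
stays in `min(p,1-p) ≥ μ₀` and `t₁ ≤ 1/2`, then `Θ_L(p₀, 0) ≤ Θ_L(p₀ - κ t₁, t₁)`.
[cite: MartineauSevero2019, §6 (the line segment argument)] -/
theorem enhTheta_line_mono (hH : H.Connected) {L : ℕ} (hL : r + 1 ≤ L) {p₀ κ μ₀ t₁ : ℝ} {NL NO : ℕ}
    (hNL : ∀ e ∈ edgesInBallFin H o (L + r), (locF H r o L e).card ≤ NL)
    (hNO : ∀ z, ((edgesInBallFin H o (L + r)).filter fun e => NearEdge H r e z).card ≤ NO)
    (hμ₀ : 0 < μ₀) (hμ1 : μ₀ ≤ 1) (hκ0 : 0 ≤ κ) (hκ : κ * enhAGconst μ₀ NL NO ≤ 1) (ht₁ : 0 ≤ t₁)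
    (ht₁' : t₁ ≤ 1 / 2) (hlo : μ₀ ≤ p₀ - κ * t₁) (hhi : p₀ ≤ 1 - μ₀) :
    enhTheta H r o L p₀ 0 ≤ enhTheta H r o L (p₀ - κ * t₁) t₁ := by
  set F : ℝ → ℝ := fun t => enhTheta H r o L (p₀ + (-κ) * t) (0 + 1 * t) with hF
  have hderiv := fun t => hasDerivAt_enhTheta_line (H := H) (r := r) (o := o) L p₀ (-κ) 0 1 t
  have hmono : MonotoneOn F (Set.Icc 0 t₁) := by
    refine monotoneOn_of_hasDerivWithinAt_nonneg (convex_Icc 0 t₁)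
      (fun t _ => (hderiv t).continuousAt.continuousWithinAt)
      (fun t _ => (hderiv t).hasDerivWithinAt) fun t ht => ?_
    rw [interior_Icc] at ht
    have hp_lo : μ₀ ≤ p₀ + (-κ) * t := hlo.trans (by nlinarith [ht.2.le, hκ0])
    have hp_hi : μ₀ ≤ 1 - (p₀ + (-κ) * t) := by nlinarith [ht.1.le, hκ0]
    have hAG := sum_enhPiv_inl_le hH hL hμ₀ hμ1 hp_lo hp_hi (s := 0 + 1 * t) (by linarith [ht.1])
      (by linarith [ht.2, ht₁']) hNL hNO
    have hB : 0 ≤ ∑ z ∈ ballFin H o L, enhPiv H r o L (p₀ + (-κ) * t) (0 + 1 * t) (Sum.inr z) :=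
      Finset.sum_nonneg fun z _ => enhPiv_nonneg L ⟨hμ₀.le.trans hp_lo, by linarith⟩
        ⟨by linarith [ht.1], by linarith [ht.2, ht₁']⟩ _
    have hC0 : 0 ≤ enhAGconst μ₀ NL NO := enhAGconst_nonneg hμ₀.le NL NO
    nlinarith [hAG, hB, hκ, hκ0, mul_nonneg hκ0 hB]
  have h := hmono (Set.left_mem_Icc.2 ht₁) (Set.right_mem_Icc.2 ht₁) ht₁
  simp only [hF] at h
  have e1 : p₀ + (-κ) * 0 = p₀ := by ring
  have e2 : (0 : ℝ) + 1 * 0 = 0 := by ring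
  have e3 : p₀ + (-κ) * t₁ = p₀ - κ * t₁ := by ring
  have e4 : (0 : ℝ) + 1 * t₁ = t₁ := by ring
  rw [e1, e2, e3, e4] at h
  exact h

/-- **Proposition 4.2 in polynomial form (the corner estimate).** Under the hypotheses of
`enhTheta_line_mono`, for every `p ∈ [p₀ - κt₁, 1]` and `s ∈ [t₁, 1]`: `Θ_L(p₀, 0) ≤ Θ_L(p, s)`
(line monotonicity, then monotonicity in `p` and in `s`). [cite: MartineauSevero2019, Proposition 4.2 (proof, §6)] -/
theorem enhTheta_ge_corner (hH : H.Connected) {L : ℕ} (hL : r + 1 ≤ L) {p₀ κ μ₀ t₁ : ℝ} {NL NO : ℕ}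
    (hNL : ∀ e ∈ edgesInBallFin H o (L + r), (locF H r o L e).card ≤ NL)
    (hNO : ∀ z, ((edgesInBallFin H o (L + r)).filter fun e => NearEdge H r e z).card ≤ NO)
    (hμ₀ : 0 < μ₀) (hμ1 : μ₀ ≤ 1) (hκ0 : 0 ≤ κ) (hκ : κ * enhAGconst μ₀ NL NO ≤ 1) (ht₁ : 0 ≤ t₁)
    (ht₁' : t₁ ≤ 1 / 2) (hlo : μ₀ ≤ p₀ - κ * t₁) (hhi : p₀ ≤ 1 - μ₀) {p s : ℝ} (hp : p₀ - κ * t₁ ≤ p)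
    (hp1 : p ≤ 1) (hs : t₁ ≤ s) (hs1 : s ≤ 1) :
    enhTheta H r o L p₀ 0 ≤ enhTheta H r o L p s := by
  have h1 := enhTheta_line_mono hH hL hNL hNO hμ₀ hμ1 hκ0 hκ ht₁ ht₁' hlo hhi
  have h2 : enhTheta H r o L (p₀ - κ * t₁) t₁ ≤ enhTheta H r o L p t₁ :=
    enhTheta_mono_p L ht₁ (by linarith) (hμ₀.le.trans hlo) hp hp1
  have h3 : enhTheta H r o L p t₁ ≤ enhTheta H r o L p s :=
    enhTheta_mono_s L ((hμ₀.le.trans hlo).trans hp) hp1 ht₁ hs hs1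
  exact h1.trans (h2.trans h3)

end AG

end Literature.Probability.Percolation
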